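/-
Copyright (c) 2026 the pub-hodgecm-mathlib formalisation cell (harness21).  Prover seat hodgecm-mathlib-K2E3-p12 (g8), Track B ∕ K2-LIT, h413 = `stmt-HodgeConjecture-24833`,
line `K2_E1_TraceFormulaBeta`, 5Res ROADCARD «ENDGAME BY FAMILIES» (K2E1-plan (g7), (154)) file C1 «f3-χ» (deal (142)), part H-b: the CROSS-FAMILY VANISHING (XF) and the OFF-DUAL
ONE-TERM FORMULA (OD) for twisted pseudo-Eisenstein series on `U(1,1)_{L∕L⁺}` — letter-free (★ H-a split ∘ ★ GR-χ Lemma B on `𝓕_I` ∘ ★ C ∘ ★ A Parseval I).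
-/
import Summits.HodgeConjecture.HodgeConjecture.Theorems.K2E1ChiPseudoEisensteinIdeleSplitCMTwo       -- ★ H-a (this seat): `⟨θ,θ′⟩ = C(∫G₁ + ∫G₂)`, both integrable; transitively ★ W-b, ★ C, ★ A
import Summits.HodgeConjecture.HodgeConjecture.Theorems.K2E1IdeleClassCharacterOrthogonality        -- ★ GR-χ p860004 (this seat): Lemma B on `𝓕_I`, `χ·conj χ′ = χχ′⁻¹` for unitary `χ′`
import HarnessLib

/-!
# C1 «f3-χ», part H-b — `K2E1ChiPseudoEisensteinInnerProductCMTwo`: (XF) `⟨θ_{f,φ_χ}, θ_{f′,φ′_{χ′}}⟩ = 0` UNLESS `χχ′⁻¹` OR `χ(χ′ʷ)⁻¹` IS A NORM TWIST; (OD) for `χ′ = χ` OFF-DUAL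
# (`χ(χʷ)⁻¹` not a norm twist): `⟨θ_{f,φ}, θ_{f′,φ′}⟩ = C·(2π)⁻¹∫_ℝ f̃(z)·conj f̃′(1 − z̄) dy · ⟪φ,φ′⟫_K` — ONE term, no intertwining operator, no contour shift (ROADCARD (154) §1)

Track B ∕ K2-LIT, crux h413 = `stmt-HodgeConjecture-24833`, route of record `HCCMUnconditional`; cell `hodgecm-mathlib`, squad K2, ENGINE E1.  THEOREMS ONLY (no `def`, no `instance`,
no `notation`, no named-fact hypothesis, no `sorry`); lane `--supports stmt-HodgeConjecture-24833 --as helper` (count-neutral).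
THE MATHEMATICS ([MoeglinWaldspurger1995, II.2.1]; [TateThesis1967, Thm. 4.4.1]; [Rogawski1990, §7.3]; [GelbartRogawski1991, §3.1]; ROADCARD (154) §0–§1).  By ★ H-a, for unitary `χ, χ′` and
`χ`-∕`χ′`-sections `φ, φ′`: `⟨θ_{f,φ},θ_{f′,φ′}⟩_X = C(∫_{𝓕_I}G₁ + ∫_{𝓕_I}G₂)` with `G₁(x) = ‖x‖⁻¹•(χ(x)conj χ′(x)·R₁(‖x‖))`, `G₂(x) = ‖x‖⁻¹•(χ(x)conj χ′ʷ(x)·R₂(‖x‖))`.  Unitarity gives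
`χ·conj χ′ = χχ′⁻¹`, `χ·conj χ′ʷ = χ(χ′ʷ)⁻¹` (★ GR-χ `apply_mul_conj_apply_of_isUnitary`; `χ′ʷ` unitary, ★ H-a `norm_reflectChar_apply_of_isUnitary`), so `G_i(a x) = ξ_i(a)G_i(x)` for norm-one
`a`, and ★ GR-χ LEMMA B ON `𝓕_I` (`setIntegral_ideleClass_smul_mul_eq_zero_of_not_isNormTwist`) kills `∫G₁` unless `ξ₁ = χχ′⁻¹` is a norm twist and `∫G₂` unless `ξ₂ = χ(χ′ʷ)⁻¹` is one:
(XF) both fail ⇒ `⟨θ_{f,φ},θ_{f′,φ′}⟩ = 0` — distinct NON-ASSOCIATE families of twisted pseudo-Eisenstein series are orthogonal; (OD) `χ′ = χ`, `χ(χʷ)⁻¹` not a norm twist (the family is not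
self-associate) ⇒ only the `w = 1` term survives: `|χ|² = 1`, `G₁` is RADIAL, ★ C `∫_{𝓕_I}‖x‖⁻¹•φ₀(‖x‖) = V•∫_0^∞ φ₀(r)r⁻² dr` and ★ A Parseval I give the ONE-TERM inner product formula
`C·V·(2π)⁻¹∫ f̃(z)conj f̃′(1−z̄) dy·⟪φ,φ′⟫_K` (`⟪φ,φ′⟫_K = ∫_{K_U} φ conj φ′ dμ_K`) — the family `Θ_χ` is isometric to `L²(ℝ_{>0}, dr∕r²)⊗V(χ)` with no residual part (ROADCARD (154) §1 (OD): `R_χ = 0`).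
The self-dual two-term formula (SD) (both terms, `M(z)`-pairing; Final's twin) is part H-c.
* §1 **`chiPseudoEisenstein_inner_product_eq_zero_cm_two`** (XF).  * §2 **`chiPseudoEisenstein_inner_product_offDual_cm_two`** (OD).
HONEST LABEL: HC_CM is proved only modulo the 7 printed citations (2 remaining named inputs: hLiu418 = `stmt-HodgeConjecture-24832`, h413 = `stmt-HodgeConjecture-24833`) until rung 0
closes; this file asserts no named fact, closes no socket; count-neutral; letter-free.

## References
* [MoeglinWaldspurger1995] C. Mœglin, J.-L. Waldspurger, *Spectral decomposition and Eisenstein series* (1995), II.2.1.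
* [TateThesis1967] J. Tate, *Fourier analysis in number fields and Hecke's zeta-functions*, in Cassels–Fröhlich (1967), Thm. 4.4.1.
* [Rogawski1990] J. D. Rogawski, *Automorphic Representations of Unitary Groups in Three Variables* (1990), §7.3 pp. 96–98.
* [GelbartRogawski1991] S. Gelbart, J. Rogawski, *L-functions and Fourier–Jacobi coefficients for the unitary group U(3)*, Invent. Math. 105 (1991), §3.1.
-/

set_option autoImplicit false
set_option linter.dupNamespace false  -- the mandated namespace repeats the summit's segment (`HodgeConjecture.HodgeConjecture`)

noncomputable section

open MeasureTheory Measure Set Filter Topology Complex NumberField IsDedekindDomain MulAction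
open scoped Real NNReal ENNReal ComplexConjugate Pointwise
open Literature.MeasureTheory.Group Literature.NumberTheory
open Literature.NumberTheory.Automorphic Literature.NumberTheory.Automorphic.UnitaryGroup AdelicGroupData
open Literature.NumberTheory.GaloisRepresentations (HeckeCharacter ideleGroup)
open Summit.HodgeConjecture.HodgeConjecture.Cruxes.H413.K2E1BorelEisensteinU
open Summit.HodgeConjecture.HodgeConjecture.Cruxes.H413.K2E1CharacterEisensteinU2Defs
open Summit.HodgeConjecture.HodgeConjecture.Cruxes.H413.K2E1MellinPaleyWienerHalfLine (setIntegral_mul_conj_mul_cpow_eq)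
open Summit.HodgeConjecture.HodgeConjecture.Cruxes.H413.K2E1IdeleClassRadialIntegralCM (setIntegral_inv_ideleNorm_smul_comp_eq)
open Summit.HodgeConjecture.HodgeConjecture.Cruxes.H413.K2E1ChiPseudoEisensteinIdeleSplitCMTwo (chiPseudoEisenstein_inner_product_eq_sum_setIntegral_ideleClass_cm_two norm_reflectChar_apply_of_isUnitary)
open Summit.HodgeConjecture.HodgeConjecture.Cruxes.H413.K2E1IdeleClassCharacterOrthogonality (setIntegral_ideleClass_smul_mul_eq_zero_of_not_isNormTwist apply_mul_conj_apply_of_isUnitary)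

namespace Summit.HodgeConjecture.HodgeConjecture.Cruxes.H413.K2E1ChiPseudoEisensteinInnerProductCMTwo

variable (L : Type) [Field L] [NumberField L] [IsCMField L]
variable [MeasurableSpace (quasiSplit (↥(maximalRealSubfield L)) L (IsCMField.complexConj L) 2).Adelic] [BorelSpace (quasiSplit (↥(maximalRealSubfield L)) L (IsCMField.complexConj L) 2).Adelic]
variable [MeasurableSpace (AdeleRing (𝓞 L) L)ˣ] [BorelSpace (AdeleRing (𝓞 L) L)ˣ]

/-! ## §1 (XF): non-associate families of twisted pseudo-Eisenstein series are orthogonal -/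

/-- **(XF) CROSS-FAMILY VANISHING.**  Data as in ★ W-b∕H-a.  For UNITARY Hecke characters `χ, χ′` of `L` such that NEITHER `χ·χ′⁻¹` NOR `χ·(χ′ʷ)⁻¹` is a norm twist (`χ′ʷ = reflectChar c χ′`;
i.e. the data `(χ′)` is associate to neither `χ` nor `χʷ` up to `‖·‖^s`), all continuous bounded `χ`-∕`χ′`-sections `φ, φ′`, all `f, f′ ∈ C²_c((0,∞))`: the twisted pseudo-Eisenstein series
`θ_{f,φ} = E((f∘H)φ)` and `θ_{f′,φ′}` are ORTHOGONAL in `L²(X, μ)`: the pairing is integrable and **`∫_X θ_{f,φ}·conj θ_{f′,φ′} dμ = 0`** (★ H-a split; ★ GR-χ Lemma B on `𝓕_I` kills both the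
`w = 1` term, character `χχ′⁻¹`, and the `w = w₀` term, character `χ(χ′ʷ)⁻¹`). [cite: MoeglinWaldspurger1995, II.2.1] [cite: TateThesis1967, Thm. 4.4.1 (Lemma B)] -/
theorem chiPseudoEisenstein_inner_product_eq_zero_cm_two
    (μ : Measure (quasiSplit (↥(maximalRealSubfield L)) L (IsCMField.complexConj L) 2).automorphicQuotient) [(quasiSplit (↥(maximalRealSubfield L)) L (IsCMField.complexConj L) 2).IsAutomorphicMeasure μ]
    (νG : Measure (quasiSplit (↥(maximalRealSubfield L)) L (IsCMField.complexConj L) 2).Adelic) [νG.IsHaarMeasure] [νG.IsInvInvariant]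
    (μK : Measure ((standardMaximalCompactGL 2 L).comap (adelicVal (↥(maximalRealSubfield L)) L (IsCMField.complexConj L) 2 ((StdForm.antidiagonal 2).over L)) : Subgroup (quasiSplit (↥(maximalRealSubfield L)) L (IsCMField.complexConj L) 2).Adelic)) [μK.IsHaarMeasure]
    (νI : Measure (AdeleRing (𝓞 L) L)ˣ) [νI.IsHaarMeasure]
    {𝓕I : Set (AdeleRing (𝓞 L) L)ˣ} (h𝓕I : IsIdeleClassDomain L 𝓕I)
    (ν : Measure ↥(adelicUnipotent (↥(maximalRealSubfield L)) L (IsCMField.complexConj L) 2)) [ν.IsHaarMeasure] {𝓕 : Set ↥(adelicUnipotent (↥(maximalRealSubfield L)) L (IsCMField.complexConj L) 2)}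
    (h𝓕N : IsFundamentalDomain ↥(rationalUnipotent (↥(maximalRealSubfield L)) L (IsCMField.complexConj L) 2) 𝓕 ν) (h𝓕c : IsCompact (closure 𝓕)) (h𝓕₀ : ν 𝓕 ≠ 0)
    {χ χ' : HeckeCharacter L} {φ φ' : (quasiSplit (↥(maximalRealSubfield L)) L (IsCMField.complexConj L) 2).Adelic → ℂ} (hχu : χ.IsUnitary) (hχ'u : χ'.IsUnitary)
    (h₁ : ¬ (χ * χ'⁻¹).IsNormTwist) (h₂ : ¬ (χ * (reflectChar (IsCMField.complexConj L) χ')⁻¹).IsNormTwist)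
    (hφ : IsChiSection χ φ) (hφc : Continuous φ) {Cφ : ℝ} (hφC : ∀ x, ‖φ x‖ ≤ Cφ)
    (hφ' : IsChiSection χ' φ') (hφ'c : Continuous φ') {Cφ' : ℝ} (hφ'C : ∀ x, ‖φ' x‖ ≤ Cφ')
    {f f' : ℝ → ℂ} (hf : ContDiff ℝ 2 f) (hfs : HasCompactSupport f) (hf0 : tsupport f ⊆ Ioi 0) (hf' : ContDiff ℝ 2 f') (hf's : HasCompactSupport f') (hf'0 : tsupport f' ⊆ Ioi 0) :
    Integrable (fun x : (quasiSplit (↥(maximalRealSubfield L)) L (IsCMField.complexConj L) 2).automorphicQuotient =>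
            (quasiSplit (↥(maximalRealSubfield L)) L (IsCMField.complexConj L) 2).quotFun (eisensteinSeriesU (fun g : (quasiSplit (↥(maximalRealSubfield L)) L (IsCMField.complexConj L) 2).Adelic => f (borelHeight g : ℝ) * φ g)) x * conj ((quasiSplit (↥(maximalRealSubfield L)) L (IsCMField.complexConj L) 2).quotFun (eisensteinSeriesU (fun g : (quasiSplit (↥(maximalRealSubfield L)) L (IsCMField.complexConj L) 2).Adelic => f' (borelHeight g : ℝ) * φ' g)) x)) μ ∧
    ∫ x, (quasiSplit (↥(maximalRealSubfield L)) L (IsCMField.complexConj L) 2).quotFun (eisensteinSeriesU (fun g : (quasiSplit (↥(maximalRealSubfield L)) L (IsCMField.complexConj L) 2).Adelic => f (borelHeight g : ℝ) * φ g)) x * conj ((quasiSplit (↥(maximalRealSubfield L)) L (IsCMField.complexConj L) 2).quotFun (eisensteinSeriesU (fun g : (quasiSplit (↥(maximalRealSubfield L)) L (IsCMField.complexConj L) 2).Adelic => f' (borelHeight g : ℝ) * φ' g)) x) ∂μ = 0 := by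
  obtain ⟨C, -, hH⟩ := chiPseudoEisenstein_inner_product_eq_sum_setIntegral_ideleClass_cm_two L μ νG μK νI h𝓕I ν h𝓕N h𝓕c h𝓕₀
  obtain ⟨-, -, hInt, hEq⟩ := hH hχu hχ'u hφ hφc hφC hφ' hφ'c hφ'C hf hfs hf0 hf' hf's hf'0 (σ₀ := 2) one_lt_two
  refine ⟨hInt, ?_⟩
  have hnorm : ∀ a : (AdeleRing (𝓞 L) L)ˣ, IdeleClassGroup.ideleNorm L a = 1 → ∀ x : (AdeleRing (𝓞 L) L)ˣ, (IdeleClassGroup.ideleNorm L (a * x) : ℝ)⁻¹ = (IdeleClassGroup.ideleNorm L x : ℝ)⁻¹ := fun a ha x => by rw [map_mul, ha, one_mul]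
  have hχw'u : (reflectChar (IsCMField.complexConj L) χ').IsUnitary := fun a => norm_reflectChar_apply_of_isUnitary hχ'u a
  have hI₁ : ∫ x in 𝓕I, (IdeleClassGroup.ideleNorm L x : ℝ)⁻¹ • ((((χ x : ℂˣ) : ℂ) * conj ((χ' x : ℂˣ) : ℂ)) * ((f (IdeleClassGroup.ideleNorm L x : ℝ) * conj (f' (IdeleClassGroup.ideleNorm L x : ℝ))) * ∫ k : ((standardMaximalCompactGL 2 L).comap (adelicVal (↥(maximalRealSubfield L)) L (IsCMField.complexConj L) 2 ((StdForm.antidiagonal 2).over L)) : Subgroup (quasiSplit (↥(maximalRealSubfield L)) L (IsCMField.complexConj L) 2).Adelic), φ (k : (quasiSplit (↥(maximalRealSubfield L)) L (IsCMField.complexConj L) 2).Adelic) * conj (φ' (k : (quasiSplit (↥(maximalRealSubfield L)) L (IsCMField.complexConj L) 2).Adelic)) ∂μK)) ∂νI = 0 := by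
    simp_rw [apply_mul_conj_apply_of_isUnitary χ hχ'u]
    exact setIntegral_ideleClass_smul_mul_eq_zero_of_not_isNormTwist νI h𝓕I h₁ hnorm fun a ha x => by rw [map_mul, ha, one_mul]
  have hI₂ : ∫ x in 𝓕I, (IdeleClassGroup.ideleNorm L x : ℝ)⁻¹ • ((((χ x : ℂˣ) : ℂ) * conj (((reflectChar (IsCMField.complexConj L) χ') x : ℂˣ) : ℂ)) * (f (IdeleClassGroup.ideleNorm L x : ℝ) * ∫ k : ((standardMaximalCompactGL 2 L).comap (adelicVal (↥(maximalRealSubfield L)) L (IsCMField.complexConj L) 2 ((StdForm.antidiagonal 2).over L)) : Subgroup (quasiSplit (↥(maximalRealSubfield L)) L (IsCMField.complexConj L) 2).Adelic), φ (k : (quasiSplit (↥(maximalRealSubfield L)) L (IsCMField.complexConj L) 2).Adelic) * conj (((ν 𝓕).toReal⁻¹ : ℝ) • ((((2 * π)⁻¹ : ℝ) : ℂ) * ∫ y : ℝ, mellin f' (-(((2 : ℝ) : ℂ) + y * I)) * (((((IdeleClassGroup.ideleNorm L x : ℝ≥0) : ℝ) : ℂ) * ((((IdeleClassGroup.ideleNorm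 L x)⁻¹ : ℝ≥0) : ℝ) : ℂ) ^ (((2 : ℝ) : ℂ) + y * I)) * ∫ v : ↥(adelicUnipotent (↥(maximalRealSubfield L)) L (IsCMField.complexConj L) 2), flatSectionU φ' (((2 : ℝ) : ℂ) + y * I) (((quasiSplit (↥(maximalRealSubfield L)) L (IsCMField.complexConj L) 2).toAdelic (weylLongU ((IsCMField.complexConj L : L ≃ₐ[↥(maximalRealSubfield L)] L) : L →+* L) (rfl : (StdForm.antidiagonal 2).over L = (StdForm.antidiagonal 2).over L))) * ((v : (quasiSplit (↥(maximalRealSubfield L)) L (IsCMField.complexConj L) 2).Adelic) * (k : (quasiSplit (↥(maximalRealSubfield L)) L (IsCMField.complexConj L) 2).Adelic))) ∂ν))) ∂μK)) ∂νI = 0 := by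
    simp_rw [apply_mul_conj_apply_of_isUnitary χ hχw'u]
    exact setIntegral_ideleClass_smul_mul_eq_zero_of_not_isNormTwist νI h𝓕I h₂ hnorm fun a ha x => by simp_rw [map_mul, ha, one_mul]
  rw [hEq, hI₁, hI₂, add_zero, mul_zero]

/-! ## §2 (OD): the off-dual ONE-TERM inner product formula -/

/-- **(OD) THE OFF-DUAL ONE-TERM FORMULA.**  Data as in ★ W-b∕H-a; there is ONE `C > 0` (`= c_μ·K·V`, `V = idelicCovolume`) such that for every UNITARY Hecke character `χ` of `L` whose family
is NOT self-associate (`χ·(χʷ)⁻¹` not a norm twist, `χʷ = reflectChar c χ`), all continuous bounded `χ`-sections `φ, φ′`, all `f, f′ ∈ C²_c((0,∞))` and every `σ₀ > 1` (`z = σ₀ + iy`):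
**`∫_X θ_{f,φ}·conj θ_{f,φ′} dμ = C·( (2π)⁻¹·∫_ℝ mellin f (−z)·conj (mellin f′ (z̄ − 1)) dy )·∫_{K_U} φ·conj φ′ dμ_K`** — the `w = w₀` term vanishes by Lemma B (★ GR-χ), the `w = 1` term is radial
(`|χ|² = 1`) and is evaluated by ★ C and ★ A Parseval I; no intertwining operator, no continuation, no contour shift: `Θ_χ ≅ L²(ℝ_{>0}, dr∕r²) ⊗ V(χ)` (ROADCARD (154) §1 (OD)).
[cite: MoeglinWaldspurger1995, II.2.1] [cite: TateThesis1967, Thm. 4.4.1 (Lemma B)] [cite: Rogawski1990, §7.3 (pp. 96–98)] -/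
theorem chiPseudoEisenstein_inner_product_offDual_cm_two
    (μ : Measure (quasiSplit (↥(maximalRealSubfield L)) L (IsCMField.complexConj L) 2).automorphicQuotient) [(quasiSplit (↥(maximalRealSubfield L)) L (IsCMField.complexConj L) 2).IsAutomorphicMeasure μ]
    (νG : Measure (quasiSplit (↥(maximalRealSubfield L)) L (IsCMField.complexConj L) 2).Adelic) [νG.IsHaarMeasure] [νG.IsInvInvariant]
    (μK : Measure ((standardMaximalCompactGL 2 L).comap (adelicVal (↥(maximalRealSubfield L)) L (IsCMField.complexConj L) 2 ((StdForm.antidiagonal 2).over L)) : Subgroup (quasiSplit (↥(maximalRealSubfield L)) L (IsCMField.complexConj L) 2).Adelic)) [μK.IsHaarMeasure]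
    (νI : Measure (AdeleRing (𝓞 L) L)ˣ) [νI.IsHaarMeasure]
    {𝓕I : Set (AdeleRing (𝓞 L) L)ˣ} (h𝓕I : IsIdeleClassDomain L 𝓕I)
    (ν : Measure ↥(adelicUnipotent (↥(maximalRealSubfield L)) L (IsCMField.complexConj L) 2)) [ν.IsHaarMeasure] {𝓕 : Set ↥(adelicUnipotent (↥(maximalRealSubfield L)) L (IsCMField.complexConj L) 2)}
    (h𝓕N : IsFundamentalDomain ↥(rationalUnipotent (↥(maximalRealSubfield L)) L (IsCMField.complexConj L) 2) 𝓕 ν) (h𝓕c : IsCompact (closure 𝓕)) (h𝓕₀ : ν 𝓕 ≠ 0) :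
    ∃ C : ℝ, 0 < C ∧
      ∀ {χ : HeckeCharacter L} {φ φ' : (quasiSplit (↥(maximalRealSubfield L)) L (IsCMField.complexConj L) 2).Adelic → ℂ}, χ.IsUnitary → ¬ (χ * (reflectChar (IsCMField.complexConj L) χ)⁻¹).IsNormTwist →
        IsChiSection χ φ → Continuous φ → ∀ {Cφ : ℝ}, (∀ x, ‖φ x‖ ≤ Cφ) →
        IsChiSection χ φ' → Continuous φ' → ∀ {Cφ' : ℝ}, (∀ x, ‖φ' x‖ ≤ Cφ') →
      ∀ {f f' : ℝ → ℂ}, ContDiff ℝ 2 f → HasCompactSupport f → tsupport f ⊆ Ioi 0 → ContDiff ℝ 2 f' → HasCompactSupport f' → tsupport f' ⊆ Ioi 0 →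
      ∀ {σ₀ : ℝ}, 1 < σ₀ →
        Integrable (fun x : (quasiSplit (↥(maximalRealSubfield L)) L (IsCMField.complexConj L) 2).automorphicQuotient =>
            (quasiSplit (↥(maximalRealSubfield L)) L (IsCMField.complexConj L) 2).quotFun (eisensteinSeriesU (fun g : (quasiSplit (↥(maximalRealSubfield L)) L (IsCMField.complexConj L) 2).Adelic => f (borelHeight g : ℝ) * φ g)) x * conj ((quasiSplit (↥(maximalRealSubfield L)) L (IsCMField.complexConj L) 2).quotFun (eisensteinSeriesU (fun g : (quasiSplit (↥(maximalRealSubfield L)) L (IsCMField.complexConj L) 2).Adelic => f' (borelHeight g : ℝ) * φ' g)) x)) μ ∧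
        ∫ x, (quasiSplit (↥(maximalRealSubfield L)) L (IsCMField.complexConj L) 2).quotFun (eisensteinSeriesU (fun g : (quasiSplit (↥(maximalRealSubfield L)) L (IsCMField.complexConj L) 2).Adelic => f (borelHeight g : ℝ) * φ g)) x * conj ((quasiSplit (↥(maximalRealSubfield L)) L (IsCMField.complexConj L) 2).quotFun (eisensteinSeriesU (fun g : (quasiSplit (↥(maximalRealSubfield L)) L (IsCMField.complexConj L) 2).Adelic => f' (borelHeight g : ℝ) * φ' g)) x) ∂μ =
          (C : ℂ) * (((((2 * π)⁻¹ : ℝ) : ℂ) * ∫ y : ℝ, mellin f (-((σ₀ : ℂ) + y * I)) * conj (mellin f' (conj ((σ₀ : ℂ) + y * I) - 1))) * ∫ k : ((standardMaximalCompactGL 2 L).comap (adelicVal (↥(maximalRealSubfield L)) L (IsCMField.complexConj L) 2 ((StdForm.antidiagonal 2).over L)) : Subgroup (quasiSplit (↥(maximalRealSubfield L)) L (IsCMField.complexConj L) 2).Adelic), φ (k : (quasiSplit (↥(maximalRealSubfield L)) L (IsCMField.complexConj L) 2).Adelic) * conj (φ' (k : (quasiSplit (↥(maximalRealSubfield L))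 L (IsCMField.complexConj L) 2).Adelic)) ∂μK) := by
  haveI := t2Space_adeleRing_of_numberField L
  haveI := locallyCompactSpace_adeleRing' L
  obtain ⟨C, hC, hH⟩ := chiPseudoEisenstein_inner_product_eq_sum_setIntegral_ideleClass_cm_two L μ νG μK νI h𝓕I ν h𝓕N h𝓕c h𝓕₀
  have hV0 : idelicCovolume L νI ≠ 0 := idelicCovolume_ne_zero νI
  have hVt : idelicCovolume L νI ≠ ∞ := idelicCovolume_ne_top νI
  refine ⟨C * (idelicCovolume L νI).toReal, mul_pos hC (ENNReal.toReal_pos hV0 hVt), ?_⟩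
  intro χ φ φ' hχu hoff hφ hφc Cφ hφC hφ' hφ'c Cφ' hφ'C f f' hf hfs hf0 hf' hf's hf'0 σ₀ hσ₀
  obtain ⟨-, -, hInt, hEq⟩ := hH hχu hχu hφ hφc hφC hφ' hφ'c hφ'C hf hfs hf0 hf' hf's hf'0 hσ₀
  refine ⟨hInt, ?_⟩
  have hnorm : ∀ a : (AdeleRing (𝓞 L) L)ˣ, IdeleClassGroup.ideleNorm L a = 1 → ∀ x : (AdeleRing (𝓞 L) L)ˣ, (IdeleClassGroup.ideleNorm L (a * x) : ℝ)⁻¹ = (IdeleClassGroup.ideleNorm L x : ℝ)⁻¹ := fun a ha x => by rw [map_mul, ha, one_mul]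
  have hχwu : (reflectChar (IsCMField.complexConj L) χ).IsUnitary := fun a => norm_reflectChar_apply_of_isUnitary hχu a
  -- the `w = w₀` term dies (Lemma B on `𝓕_I`)
  have hI₂ : ∫ x in 𝓕I, (IdeleClassGroup.ideleNorm L x : ℝ)⁻¹ • ((((χ x : ℂˣ) : ℂ) * conj (((reflectChar (IsCMField.complexConj L) χ) x : ℂˣ) : ℂ)) * (f (IdeleClassGroup.ideleNorm L x : ℝ) * ∫ k : ((standardMaximalCompactGL 2 L).comap (adelicVal (↥(maximalRealSubfield L)) L (IsCMField.complexConj L) 2 ((StdForm.antidiagonal 2).over L)) : Subgroup (quasiSplit (↥(maximalRealSubfield L)) L (IsCMField.complexConj L) 2).Adelic), φ (k : (quasiSplit (↥(maximalRealSubfield L)) L (IsCMField.complexConj L) 2).Adelic) * conj (((ν 𝓕).toReal⁻¹ : ℝ) • ((((2 * π)⁻¹ : ℝ) : ℂ) * ∫ y : ℝ, mellin f' (-((σ₀ : ℂ) + y * I)) * (((((IdeleClassGroup.ideleNorm L x : ℝ≥0) : ℝ) : ℂ) * ((((IdeleClassGroup.ideleNorm L x)⁻¹ : ℝ≥0) :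 ℝ) : ℂ) ^ ((σ₀ : ℂ) + y * I)) * ∫ v : ↥(adelicUnipotent (↥(maximalRealSubfield L)) L (IsCMField.complexConj L) 2), flatSectionU φ' ((σ₀ : ℂ) + y * I) (((quasiSplit (↥(maximalRealSubfield L)) L (IsCMField.complexConj L) 2).toAdelic (weylLongU ((IsCMField.complexConj L : L ≃ₐ[↥(maximalRealSubfield L)] L) : L →+* L) (rfl : (StdForm.antidiagonal 2).over L = (StdForm.antidiagonal 2).over L))) * ((v : (quasiSplit (↥(maximalRealSubfield L)) L (IsCMField.complexConj L) 2).Adelic) * (k : (quasiSplit (↥(maximalRealSubfield L)) L (IsCMField.complexConj L) 2).Adelic))) ∂ν))) ∂μK)) ∂νI = 0 := by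
    simp_rw [apply_mul_conj_apply_of_isUnitary χ hχwu]
    exact setIntegral_ideleClass_smul_mul_eq_zero_of_not_isNormTwist νI h𝓕I hoff hnorm fun a ha x => by simp_rw [map_mul, ha, one_mul]
  -- the `w = 1` term is radial: `χ·conj χ = 1`
  have hsq : ∀ x : (AdeleRing (𝓞 L) L)ˣ, ((χ x : ℂˣ) : ℂ) * conj ((χ x : ℂˣ) : ℂ) = 1 := fun x => by
    rw [mul_comm, ← Complex.normSq_eq_conj_mul_self, Complex.normSq_eq_norm_sq, hχu x]
    norm_num
  have hI₁ : ∫ x in 𝓕I, (IdeleClassGroup.ideleNorm L x : ℝ)⁻¹ • ((((χ x : ℂˣ) : ℂ) * conj ((χ x : ℂˣ) : ℂ)) * ((f (IdeleClassGroup.ideleNorm L x : ℝ) * conj (f' (IdeleClassGroup.ideleNorm L x : ℝ))) * ∫ k : ((standardMaximalCompactGL 2 L).comap (adelicVal (↥(maximalRealSubfield L)) L (IsCMField.complexConj L) 2 ((StdForm.antidiagonal 2).over L)) : Subgroup (quasiSplit (↥(maximalRealSubfield L)) L (IsCMField.complexConj L) 2).Adelic), φ (k : (quasiSplit (↥(maximalRealSubfield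 L)) L (IsCMField.complexConj L) 2).Adelic) * conj (φ' (k : (quasiSplit (↥(maximalRealSubfield L)) L (IsCMField.complexConj L) 2).Adelic)) ∂μK)) ∂νI =
      ((idelicCovolume L νI).toReal : ℂ) * (((((2 * π)⁻¹ : ℝ) : ℂ) * ∫ y : ℝ, mellin f (-((σ₀ : ℂ) + y * I)) * conj (mellin f' (conj ((σ₀ : ℂ) + y * I) - 1))) * ∫ k : ((standardMaximalCompactGL 2 L).comap (adelicVal (↥(maximalRealSubfield L)) L (IsCMField.complexConj L) 2 ((StdForm.antidiagonal 2).over L)) : Subgroup (quasiSplit (↥(maximalRealSubfield L)) L (IsCMField.complexConj L) 2).Adelic), φ (k : (quasiSplit (↥(maximalRealSubfield L)) L (IsCMField.complexConj L) 2).Adelic) * conj (φ' (k : (quasiSplit (↥(maximalRealSubfield L)) L (IsCMField.complexConj L) 2).Adelic)) ∂μK) := by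
    simp_rw [hsq, one_mul]
    rw [setIntegral_inv_ideleNorm_smul_comp_eq νI h𝓕I (φ := fun r : ℝ => f r * conj (f' r) * ∫ k : ((standardMaximalCompactGL 2 L).comap (adelicVal (↥(maximalRealSubfield L)) L (IsCMField.complexConj L) 2 ((StdForm.antidiagonal 2).over L)) : Subgroup (quasiSplit (↥(maximalRealSubfield L)) L (IsCMField.complexConj L) 2).Adelic), φ (k : (quasiSplit (↥(maximalRealSubfield L)) L (IsCMField.complexConj L) 2).Adelic) * conj (φ' (k : (quasiSplit (↥(maximalRealSubfield L)) L (IsCMField.complexConj L) 2).Adelic)) ∂μK)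
      (((hf.continuous.mul (continuous_conj.comp hf'.continuous)).comp Real.continuous_exp).mul continuous_const).aestronglyMeasurable,
      Complex.real_smul, ← setIntegral_mul_conj_mul_cpow_eq hf hfs hf0 hf'.continuous hf's hf'0 σ₀, ← integral_mul_const]
    congr 1
    refine setIntegral_congr_fun measurableSet_Ioi fun r _ => ?_
    ring
  rw [hEq, hI₁, hI₂, add_zero]
  push_cast
  ring

end Summit.HodgeConjecture.HodgeConjecture.Cruxes.H413.K2E1ChiPseudoEisensteinInnerProductCMTwo

end
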